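import Summits.BirchSwinnertonDyer.BirchSwinnertonDyer.Theorems.GenusKolyvaginAtTwoMinimalTwinBSDTwoSwappedPairExactDescent
import Summits.BirchSwinnertonDyer.BirchSwinnertonDyer.Theorems.GenusKolyvaginAtTwoMinimalTwinBSDTwoAnalyticSplit
import Summits.BirchSwinnertonDyer.BirchSwinnertonDyer.Theorems.GenusKolyvaginAtTwoMinimalTwinBSDTwoAnalyticSupplies
import Summits.BirchSwinnertonDyer.BirchSwinnertonDyer.Theorems.KolyvaginRankRigidityAtTwoKolyvaginBoundedDefectAtTwoDepthZero
import Literature.NumberTheory.EllipticCurves.BSDSelmerPConverse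
import Literature.NumberTheory.EllipticCurves.GlobalMinimalModelProofs
import Literature.NumberTheory.QuadraticFields.KroneckerSplitting
import Literature.Barriers.BirchSwinnertonDyer.PAdicFunctionalEquationParityProofs
import HarnessLib

/-!
# Route `GenusKolyvaginAtTwo`, crux U₂ `MinimalTwinBSDTwo` (stmt-BirchSwinnertonDyer-22985), LINE 23 «twin_swap» v2.4 «ANALYTIC TWIN»:
# U₂ WITHOUT ANY 2-CONVERSE — the rank-zero twin is taken ANALYTICALLY (Friedberg–Hoffstein), the swapped exact descent at Ш-depth runs for
# a twin with ARBITRARY 2-Selmer group, and U₂ ⟸ WALL row 1 + FH + KEX + PRINT (no converse item, no declared residual)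

Seat `bsd-line-gk2-p2` g27 (PROVER seat 2/3, cell `bsd-f1-sign2`, LINE 23 holder), `--supports stmt-BirchSwinnertonDyer-22985` (helper; closes
nothing).  THEOREMS ONLY (no definition, no named fact, no `sorry`); standard axioms.  **BSD is NOT proved by this file; U₂, the wall and KEX are
NOT proved; no item is closed.**  Every theorem is CONDITIONAL on its displayed hypotheses; the PRINT hypotheses are the route's statement-only
named facts (Gross–Zagier `gross_zagier`, Gross–Zagier–Kolyvagin `rank_eq_analyticRank_of_analyticRank_le_one`, modularity `hasEntireLFunction_rat`,
Milne 1972 `Milne1972.bsdQuotient_baseChange_quadratic_anyModel`, BCDT `nonempty_modularParametrizationData`) plus, NEW on this line,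
Friedberg–Hoffstein's non-vanishing twist in a prescribed Heegner class (`friedbergHoffstein_exists_heegnerField_split_twist_ne_zero`,
Literature, statement-only; used verbatim by Burungale–Skinner–Tian–Wan / Jetchev–Skinner–Wan).

THE POINT (planner currency).  Every LINE 23 skeleton so far (v1.x–v2.3) certifies that the reversed twin `Wd ≅ W^{(d_K)}` has analytic rank `0`
through `#Sel₂(Wd) = 1` and a RANK-ZERO 2-CONVERSE (items stmt-19218 + stmt-19219 of route TwoAdicConverse + the declared residual «rank-zero
2-converse off the semistable-ordinary locus at 2»).  Two observations remove all three:
(1) g26's sign-free, budget-free swapped exact descent `IdentityDoor.swappedPairDescentAtTwo_shaDepth_of_facts` (p778694) uses `#Sel₂(Wd) = 1` at ONE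
    place only — to get `rank W(ℚ) ≥ 1` — and that is Gross–Zagier–Kolyvagin (`r_an(W) = 1`), already a hypothesis: §1–§3 below re-run it for a
    globally minimal twin with ARBITRARY `2`-Selmer group (`…_anyTwin`), losslessness included;
(2) WALL row 1 (ByReductionTypeAtTwo 19095–19098) is BSD₂ for EVERY non-CM curve of analytic rank `0` — no Selmer clause — so the twin only needs
    `L(W^{(d_K)},1) ≠ 0`, and Friedberg–Hoffstein supplies an imaginary quadratic `K`, Heegner for `N_W`, `2` split (so `d_K ≡ 1 (8)`, odd), `|d_K| > 4`,
    with `L(W^{(d_K)},1) ≠ 0`, because `w(W) = −1` (`r_an(W) = 1`, parity of the functional equation).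
Hence:
* §4 ★ `bsdp_of_wall_of_friedbergHoffstein_of_kex_of_facts` — **U₂ ⟸ S1′ (BSD₂ for non-CM rank-`0` curves = WALL row 1) + FH + KEX′ + PRINT**, where
  **KEX′** = «for `W` non-CM globally minimal, `r_an = 1`, `#Sel₂ = 2`: at EVERY imaginary quadratic `K` (`d_K` odd `≠ −3`, Heegner, `2` split), EVERY
  globally minimal `Wd ≅ W^{(d_K)}`, `L(W^{(d_K)},1) ≠ 0`, EVERY conductor-`1` datum: `∃ M₀`, `2^{M₀} ∥ P(1)` ∧ `#Ш(W_K)[2^∞] · 4^{ord₂ c + ord₂ C(W)} =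
  4^{M₀}`» — the same 2-primary Gross–Zagier index relation as v2.3's KEX, over all odd Heegner frames with `2` split (v2.3 restricted it to
  `2`-Selmer-trivial prime twins);
* §5 ★ `kexAny_of_minimalTwinBSDTwo_of_wall_of_facts` — **LOSSLESS: U₂ + S1′ + PRINT ⟹ KEX′**.
So (v2.4): **hTw ⟸ WALL row 1 + KEX′ + PRINT×6 (GZ, GZK, modularity, Milne, BCDT, FH)** — NO 2-converse item, NO declared residual; and KEX′ ⟺ U₂
modulo WALL row 1 + PRINT.  Nothing here is progress on BSD.

References: [GrossZagier1986] I.(6.3), V.§2 (2.2); [GrossLMS1991] §2 (2.3), §5 Prop. 5.3; [McCallumLMS1991] §5 Lemma 5.1; [FriedbergHoffstein1995]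
main theorem; [BurungaleSkinnerTianWan2024] proof of Thm. 12.3; [Milne1972ArithmeticAV] §1 Thm. 1; [BCDTJAMS2001] Thm. A; [SilvermanAEC2009] VIII.6.7,
VIII.8 Cor. 8.3; [Kolyvagin1989Izv] Thm. A; [Miller2011LMS] Def. 1.1.
-/

set_option autoImplicit false
set_option linter.dupNamespace false -- `Summit.<P>.<Sub>` repeats `BirchSwinnertonDyer` (D-0017)

noncomputable section

open scoped Classical

open WeierstrassCurve NumberField Literature.NumberTheory.EllipticCurves
  Literature.NumberTheory.EllipticCurves.ModularForms
  Literature.NumberTheory.EllipticCurves.Rank1Residual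
  Literature.NumberTheory.EllipticCurves.Rank1Residual.Typed
  Literature.NumberTheory.EllipticCurves.KrizLi2019
  Summit.BirchSwinnertonDyer.Rank1Residual
  Summit.BirchSwinnertonDyer.Rank1Residual.AdditivePotMult
  Summit.BirchSwinnertonDyer.BirchSwinnertonDyer.Rank1Residual
  Summit.BirchSwinnertonDyer.BirchSwinnertonDyer.Theorems.CMExactDescent
  Summit.BirchSwinnertonDyer.BirchSwinnertonDyer.Theorems.GenusExact.TwinSwap
  Summit.BirchSwinnertonDyer.BirchSwinnertonDyer.Theorems.GenusExact.TwinSwap.IdentityDoor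

open Summit.BirchSwinnertonDyer.BirchSwinnertonDyer.Theorems.GenusExact.TwinSwap.Ledger.Line25
  (exists_kolyvaginHeegnerData_one_of_nonempty_modularParametrizationData not_isOfFinAddOrder_derivedPoint_one_of_rankOne_of_lValue_ne_zero)
open Summit.BirchSwinnertonDyer.BirchSwinnertonDyer.Theorems.KolyvaginAtTwo (exists_exactTwoDepth)
open Literature.NumberTheory.QuadraticFields.Quadratic (ncard_primesOver_two_eq_two_iff)

namespace Summit.BirchSwinnertonDyer.BirchSwinnertonDyer.Theorems.GenusExact.TwinSwap.AnalyticTwin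

/-! ## §1 Gross–Zagier over `K` on the swapped frame, ANY twin: `ord₂ #Ш_an(W_K) = 2M₀ − 2 ord₂ c − 2 ord₂ C(W)` -/

/-- **g26's `IdentityDoor.padicValRat_shaAnOverC_of_swappedPair` WITHOUT the `2`-Selmer-triviality of the twin.**  `W/ℚ` globally minimal with
`r_an(W) = 1`, `#Sel₂(W) = 2` (any sign, any `C(W)`); `K` imaginary quadratic, `d_K` odd `≠ −3`, Heegner for `N_W`; any datum (`c ≠ 0`); `d₁`
conductor-`1` with `P(1)` of infinite order and `2^{M₀} ∥ P(1)`; `Wd` ANY globally minimal model of `W^{(d_K)}`; PRINT `hGZ` (for `(N_W, W, K)`),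
`hGZK`, `hmod`.  Then `r_an(Wd) = 0`, `r_an(W_K) = 1`, `Ш(W_K)` finite and `#Ш_an(W_K) = q` with **`ord₂ q = 2M₀ − 2 ord₂ c − 2 ord₂ C(W)`**.  The one
use of `#Sel₂(Wd) = 1` in g26's proof (`rank W(ℚ) ≥ 1`) is replaced by Gross–Zagier–Kolyvagin for `W` itself; the rest is VERBATIM.
[cite: GrossZagier1986, V.§2 (2.2)] [cite: McCallumLMS1991, §5 Lemma 5.1] [cite: GrossLMS1991, §2 (2.3)] -/
theorem padicValRat_shaAnOverC_of_swappedPair_anyTwin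
    (W : WeierstrassCurve ℚ) [W.IsElliptic] [W.IsGloballyMinimal] [NeZero (W.conductorNorm ℤ)]
    (K : Type) [Field K] [NumberField K]
    (hGZ : gross_zagier (W.conductorNorm ℤ) W K) (hGZK : rank_eq_analyticRank_of_analyticRank_le_one) (hmod : hasEntireLFunction_rat)
    (hr : W.analyticRank = 1) (hSel : Nat.card (W.selmerGroup 2) = 2)
    (hK : IsImaginaryQuadratic K) (hodd : Odd (NumberField.discr K)) (h3 : NumberField.discr K ≠ -3)
    (hH : SatisfiesHeegnerHypothesis (W.conductorNorm ℤ) K)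
    (Dt : ModularParametrizationData W (W.conductorNorm ℤ)) (hc0 : Dt.c ≠ 0) (β : ℤ) (ι : K →+* ℂ)
    (d₁ : KolyvaginHeegnerData Dt β ι 1) (hy : ¬ IsOfFinAddOrder d₁.derivedPoint) {M₀ : ℕ}
    (hdiv : ∃ Q : (W.baseChange (ringClassField K ι 1)).toAffine.Point, ((2 ^ M₀ : ℕ) : ℤ) • Q = d₁.derivedPoint)
    (hndiv : ¬ ∃ Q : (W.baseChange (ringClassField K ι 1)).toAffine.Point, ((2 ^ (M₀ + 1) : ℕ) : ℤ) • Q = d₁.derivedPoint)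
    (Wd : WeierstrassCurve ℚ) [Wd.IsElliptic] [Wd.IsGloballyMinimal]
    (Cd : VariableChange ℚ) (hCd : Cd • W.quadraticTwist (NumberField.discr K : ℚ) = Wd) :
    Wd.analyticRank = 0 ∧ (W.baseChange K).analyticRank = 1 ∧ Finite (W.baseChange K).sha ∧
      ∃ q : ℚ, shaAnOverC (W.baseChange K) = (q : ℂ) ∧
        padicValRat 2 q = 2 * (M₀ : ℤ) - 2 * (padicValInt 2 Dt.c : ℤ) - 2 * (padicValNat 2 W.tamagawaProduct : ℤ) := by
  haveI : Fact (Nat.Prime 2) := ⟨Nat.prime_two⟩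
  haveI hEK : (W.baseChange K).IsElliptic := isElliptic_baseChange' W K
  have h2 : Module.finrank ℚ K = 2 := hK.1
  have hD0 : (NumberField.discr K : ℚ) ≠ 0 := by exact_mod_cast NumberField.discr_ne_zero K
  haveI hEt : (W.quadraticTwist (NumberField.discr K : ℚ)).IsElliptic := W.isElliptic_quadraticTwist hD0
  obtain ⟨-, hDlt⟩ := discr_emod_four_and_lt_of_odd hK hodd h3
  have hw2 : Units.torsionOrder K = 2 :=
    Literature.NumberTheory.QuadraticFields.Quadratic.torsionOrder_eq_two_of_discr_lt_neg_four h2 hDlt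
  -- the Heegner point `P₀ ∈ E(K)` below `P(1)`
  obtain ⟨P₀, Hd, hP₀, hP₀K⟩ := exists_heegnerPoint_map_eq_derivedPoint_one hK hH d₁
  have hPinf : ¬ IsOfFinAddOrder P₀ := by
    intro hfin
    apply hy
    rw [← hP₀K]
    exact (WeierstrassCurve.Affine.Point.map (W' := W)
      (algebraMap K (ringClassField K ι 1)).toRatAlgHom).isOfFinAddOrder hfin
  -- ranks over `ℚ`: `rank E(K) ≥ 1`, `rank E^(d_K)(ℚ) = 0`, hence `rank E(ℚ) ≥ 1`
  haveI : Module.Finite ℤ (W.baseChange K).toAffine.Point := (W.baseChange K).module_finite_point_holds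
  have hK1 : 1 ≤ (W.baseChange K).mordellWeilRank :=
    Literature.NumberTheory.EllipticCurves.one_le_mordellWeilRank_of_not_isOfFinAddOrder (W.baseChange K) inferInstance hPinf
  -- rank one over `ℚ` (Gross–Zagier–Kolyvagin, `r_an(W) = 1`): no Selmer hypothesis on the twin is needed
  have hrk : 1 ≤ W.mordellWeilRank := by rw [(hGZK W (le_of_eq hr)).1, hr]
  -- `E(ℚ)[2] = 0`, hence `E(K[1])[2^M] = 0` and `E(K)[2] = 0`
  obtain ⟨-, hT2, -⟩ := rank_eq_one_and_sha_primary_eq_zero_of_natCard_selmerGroup_eq_two W hSel hrk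
  have hT2' : ∀ P : W.toAffine.Point, 2 • P = 0 → P = 0 := fun P hP ↦ by convert hT2 P (by convert hP)
  have htor1 : ∀ (M : ℕ) (R : (W.baseChange (ringClassField K ι 1)).toAffine.Point),
      ((2 ^ M : ℕ) : ℤ) • R = 0 → R = 0 :=
    fun M R hR ↦ eq_zero_of_two_pow_smul_eq_zero_ringClassField_of_noTwoTorsion W hK hodd hH hT2' ι M R hR
  have hiv : ∀ x : (W.baseChange K).toAffine.Point, 2 • x = 0 → x = 0 := fun x hx ↦
    forall_two_zsmul_baseChange_eq_zero_of_heegner W K hK hodd hH hT2' x (by rw [← natCast_zsmul] at hx; exact_mod_cast hx)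
  -- analytic ranks
  have hrt : (W.quadraticTwist (NumberField.discr K : ℚ)).analyticRank = 0 :=
    analyticRank_twist_eq_zero_of_rankOne W K hGZ hmod hK hH hr ⟨Dt, Hd, ι, hP₀⟩ hPinf
  have hrd : Wd.analyticRank = 0 := by rw [← hCd, analyticRank_smul, hrt]
  have hrK : (W.baseChange K).analyticRank = 1 :=
    (P2.analyticRank_baseChange_eq_one_iff W K hmod h2).mpr (Or.inl ⟨hr, hrt⟩)
  -- Gross–Zagier over `K`
  obtain ⟨hrkK, hShaK, -, hshaC⟩ := shaAnOverC_baseChange_eq_of_heegner W K Dt Hd ι P₀ hGZ hGZK hmod hK hH hP₀ hc0 hrK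
  haveI hfinK : Finite (W.baseChange K).sha := hShaK
  -- `ord₂ [E(K) : ℤP₀] = M₀`
  have hdivK : ∃ Q : (W.baseChange K).toAffine.Point, ((2 ^ M₀ : ℕ) : ℤ) • Q = P₀ :=
    (X11b.Three.Koly.pDiv_one_iff_exists_zsmul_eq hK d₁ P₀ hP₀K 2 M₀ (htor1 M₀)).mp hdiv
  have hndivK : ¬ ∃ Q : (W.baseChange K).toAffine.Point, ((2 ^ (M₀ + 1) : ℕ) : ℤ) • Q = P₀ :=
    fun h ↦ hndiv ((X11b.Three.Koly.pDiv_one_iff_exists_zsmul_eq hK d₁ P₀ hP₀K 2 (M₀ + 1) (htor1 (M₀ + 1))).mpr h)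
  haveI : Finite (AddCommGroup.torsion (W.baseChange K).toAffine.Point) :=
    WeierstrassCurve.finite_torsion_point (W := W.baseChange K)
  obtain ⟨cc, Q, hcQ, hcker⟩ := X11b.RankOne.exists_coord_of_mordellWeilRank_eq_one (W.baseChange K) hrkK
  have hidx : padicValNat 2 (AddSubgroup.zmultiples P₀).index = M₀ :=
    X11b.Three.Koly.padicValNat_index_zmultiples_eq_of_divisibility (p := 2) cc Q hcQ hcker hiv P₀ hdivK hndivK
  set I := (AddSubgroup.zmultiples P₀).index with hI_def
  have hI0 : I ≠ 0 := fun hI ↦ by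
    have hh := P2.torsionOrder_sq_mul_canonicalHeight_eq_index_sq_mul_regulator (W.baseChange K) hrkK P₀ hPinf
    rw [← hI_def, hI, Nat.cast_zero, zero_pow two_ne_zero, zero_mul, mul_eq_zero, pow_eq_zero_iff two_ne_zero,
      Nat.cast_eq_zero] at hh
    exact hh.elim (W.baseChange K).torsionOrder_pos_holds.ne'
      (fun h0 ↦ hPinf ((Affine.Point.canonicalHeight_eq_zero_iff_holds P₀).mp h0))
  set q : ℚ := 4 * (I : ℚ) ^ 2 /
      ((Dt.c : ℚ) ^ 2 * (Units.torsionOrder K : ℚ) ^ 2 * ((W.tamagawaProduct : ℚ) ^ 2)) with hq_def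
  have hcQ0 : (Dt.c : ℚ) ≠ 0 := by exact_mod_cast hc0
  have hcW0 : (W.tamagawaProduct : ℚ) ≠ 0 := by exact_mod_cast W.tamagawaProduct_pos_holds.ne'
  have hIQ0 : (I : ℚ) ≠ 0 := by exact_mod_cast hI0
  have hq' : q = ((I : ℚ) / ((Dt.c : ℚ) * (W.tamagawaProduct : ℚ))) ^ 2 := by
    rw [hq_def, hw2]
    push_cast
    field_simp
    ring
  have hvc : padicValRat 2 (Dt.c : ℚ) = padicValInt 2 Dt.c := padicValRat.of_int
  have hval : padicValRat 2 q = 2 * (M₀ : ℤ) - 2 * (padicValInt 2 Dt.c : ℤ) - 2 * (padicValNat 2 W.tamagawaProduct : ℤ) := by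
    rw [hq', padicValRat.pow, padicValRat.div hIQ0 (mul_ne_zero hcQ0 hcW0),
      padicValRat.mul hcQ0 hcW0, hvc, padicValRat.of_nat, padicValRat.of_nat, hidx]
    push_cast
    ring
  exact ⟨hrd, hrK, hShaK, q, hshaC, hval⟩

/-! ## §2 The swapped exact descent at Ш-depth, ANY twin -/

/-- **g26's `IdentityDoor.swappedPairDescentAtTwo_shaDepth_of_facts` WITHOUT the `2`-Selmer-triviality of the twin**, modulo the same four PRINT
facts: for the rank-ONE `2`-Selmer-minimal member `W` (`r_an = 1`, `#Sel₂ = 2`, any sign, any `C(W)`), a Heegner field `K` (`d_K` odd `≠ −3`), any datum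
(`c ≠ 0`), `P(1)` of infinite order with `2^{M₀} ∥ P(1)`, the exactness-shaped input `#Ш(W_K)[2^∞] · 2^{2(ord₂ c + ord₂ C(W))} = 2^{2M₀}`, and ANY
globally minimal model `Wd` of `W^{(d_K)}` (any `Sel₂(Wd)`, any Tamagawa budget): **`BSD₂(Wd) → BSD₂(W)`** (§1 ⟹ `MissingPPartOverCAt (W ⊗ K) 2`;
`r_an(Wd) = 0`; `AdditivePotMult.bsdp_of_pPartOverC_baseChange`).  CONDITIONAL on the four named facts; closes nothing.
[cite: GrossZagier1986, V.§2 (pp. 310–312)] [cite: GrossLMS1991, §2 (2.3), §5 Prop. 5.3] [cite: Milne1972ArithmeticAV, §1 Thm. 1]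
[cite: McCallumLMS1991, §5 Lemma 5.1] [cite: Miller2011LMS, Def. 1.1] -/
theorem swappedPairDescentAtTwo_shaDepth_anyTwin_of_facts
    (hGZ : ∀ (N : ℕ) [NeZero N] (W : WeierstrassCurve ℚ) (K : Type) [Field K] [NumberField K],
      gross_zagier N W K)
    (hGZK : rank_eq_analyticRank_of_analyticRank_le_one) (hmod : hasEntireLFunction_rat)
    (hMilneC : Milne1972.bsdQuotient_baseChange_quadratic_anyModel) :
    ∀ (W : WeierstrassCurve ℚ) [W.IsElliptic] [W.IsGloballyMinimal] [NeZero (W.conductorNorm ℤ)],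
      W.analyticRank = 1 → Nat.card (W.selmerGroup 2) = 2 →
      ∀ (K : Type) [Field K] [NumberField K], IsImaginaryQuadratic K → Odd (NumberField.discr K) →
      NumberField.discr K ≠ -3 → SatisfiesHeegnerHypothesis (W.conductorNorm ℤ) K →
      ∀ (Dt : ModularParametrizationData W (W.conductorNorm ℤ)), Dt.c ≠ 0 →
      ∀ (β : ℤ) (ι : K →+* ℂ) (d₁ : KolyvaginHeegnerData Dt β ι 1), ¬ IsOfFinAddOrder d₁.derivedPoint →
      ∀ (M₀ : ℕ),
        (∃ Q : (W.baseChange (ringClassField K ι 1)).toAffine.Point, ((2 ^ M₀ : ℕ) : ℤ) • Q = d₁.derivedPoint) →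
        (¬ ∃ Q : (W.baseChange (ringClassField K ι 1)).toAffine.Point, ((2 ^ (M₀ + 1) : ℕ) : ℤ) • Q = d₁.derivedPoint) →
        Nat.card (AddCommGroup.primaryComponent (W.baseChange K).sha 2) *
            2 ^ (2 * (padicValInt 2 Dt.c + padicValNat 2 W.tamagawaProduct)) = 2 ^ (2 * M₀) →
      ∀ (Wd : WeierstrassCurve ℚ) [Wd.IsElliptic] [Wd.IsGloballyMinimal],
        (∃ C : WeierstrassCurve.VariableChange ℚ, C • W.quadraticTwist (NumberField.discr K : ℚ) = Wd) →
        BSDp Wd 2 → BSDp W 2 := by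
  intro W _ _ _ hr hSel K _ _ hK hodd h3 hH Dt hc0 β ι d₁ hy M₀ hdiv hndiv hsha Wd _ _ hWd hBd
  haveI : Fact (Nat.Prime 2) := ⟨Nat.prime_two⟩
  haveI hEK : (W.baseChange K).IsElliptic := isElliptic_baseChange' W K
  have h2 : Module.finrank ℚ K = 2 := hK.1
  obtain ⟨Cd, hCd⟩ := hWd
  obtain ⟨hrd, -, hShaK, q, hshaC, hval⟩ := padicValRat_shaAnOverC_of_swappedPair_anyTwin W K (hGZ _ W K) hGZK hmod
    hr hSel hK hodd h3 hH Dt hc0 β ι d₁ hy hdiv hndiv Wd Cd hCd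
  haveI : Finite (W.baseChange K).sha := hShaK
  -- `ord₂ #Ш(W_K) = 2M₀ − 2e` from the exactness-shaped input
  have hcard_pos : 0 < Nat.card (AddCommGroup.primaryComponent (W.baseChange K).sha 2) := Nat.card_pos
  have hshaV : (padicValNat 2 (W.baseChange K).shaOrder : ℤ) =
      2 * (M₀ : ℤ) - 2 * (padicValInt 2 Dt.c : ℤ) - 2 * (padicValNat 2 W.tamagawaProduct : ℤ) := by
    rw [X11b.Three.Koly.padicValNat_shaOrder_eq (W.baseChange K) 2]
    have h := congrArg (padicValNat 2) hsha
    rw [padicValNat.mul hcard_pos.ne' (pow_ne_zero _ two_ne_zero), padicValNat.prime_pow, padicValNat.prime_pow] at h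
    omega
  have hKin : MissingPPartOverCAt (W.baseChange K) 2 := ⟨q, hshaC, by rw [hval, hshaV]⟩
  exact bsdp_of_pPartOverC_baseChange W 2 K Wd hGZK hmod hMilneC hr.le h2 ⟨Cd, hCd⟩
    (by rw [hrd]; exact zero_le_one) hKin hBd

/-! ## §3 Losslessness on one frame, ANY twin -/

/-- **g26's `IdentityDoor.natCard_sha_mul_eq_of_bsdp` WITHOUT the `2`-Selmer-triviality of the twin**: on the frame of §1, `BSD₂(W) ∧ BSD₂(Wd)` + PRINT
force `#Ш(W_K)[2^∞] · 2^{2(ord₂ c + ord₂ C(W))} = 2^{2M₀}` for the exact depth `M₀` of `P(1)` — ANY globally minimal model `Wd` of `W^{(d_K)}`.  CONDITIONAL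
on the two `BSD₂` hypotheses and the named facts; nothing about BSD is proved.
[cite: GrossZagier1986, V.§2 (2.2)] [cite: Milne1972ArithmeticAV, §1 Thm. 1] [cite: McCallumLMS1991, §5 Lemma 5.1] [cite: Miller2011LMS, Def. 1.1] -/
theorem natCard_sha_mul_eq_of_bsdp_anyTwin
    (W : WeierstrassCurve ℚ) [W.IsElliptic] [W.IsGloballyMinimal] [NeZero (W.conductorNorm ℤ)]
    (K : Type) [Field K] [NumberField K]
    (hGZ : gross_zagier (W.conductorNorm ℤ) W K) (hGZK : rank_eq_analyticRank_of_analyticRank_le_one)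
    (hmod : hasEntireLFunction_rat) (hMilneC : Milne1972.bsdQuotient_baseChange_quadratic_anyModel)
    (hr : W.analyticRank = 1) (hSel : Nat.card (W.selmerGroup 2) = 2)
    (hK : IsImaginaryQuadratic K) (hodd : Odd (NumberField.discr K)) (h3 : NumberField.discr K ≠ -3)
    (hH : SatisfiesHeegnerHypothesis (W.conductorNorm ℤ) K)
    (Dt : ModularParametrizationData W (W.conductorNorm ℤ)) (hc0 : Dt.c ≠ 0) (β : ℤ) (ι : K →+* ℂ)
    (d₁ : KolyvaginHeegnerData Dt β ι 1) (hy : ¬ IsOfFinAddOrder d₁.derivedPoint) {M₀ : ℕ}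
    (hdiv : ∃ Q : (W.baseChange (ringClassField K ι 1)).toAffine.Point, ((2 ^ M₀ : ℕ) : ℤ) • Q = d₁.derivedPoint)
    (hndiv : ¬ ∃ Q : (W.baseChange (ringClassField K ι 1)).toAffine.Point, ((2 ^ (M₀ + 1) : ℕ) : ℤ) • Q = d₁.derivedPoint)
    (Wd : WeierstrassCurve ℚ) [Wd.IsElliptic] [Wd.IsGloballyMinimal]
    (hWd : ∃ C : VariableChange ℚ, C • W.quadraticTwist (NumberField.discr K : ℚ) = Wd)
    (hBW : BSDp W 2) (hBd : BSDp Wd 2) :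
    Nat.card (AddCommGroup.primaryComponent (W.baseChange K).sha 2) *
        2 ^ (2 * (padicValInt 2 Dt.c + padicValNat 2 W.tamagawaProduct)) = 2 ^ (2 * M₀) := by
  haveI : Fact (Nat.Prime 2) := ⟨Nat.prime_two⟩
  haveI hEK : (W.baseChange K).IsElliptic := isElliptic_baseChange' W K
  have h2 : Module.finrank ℚ K = 2 := hK.1
  obtain ⟨Cd, hCd⟩ := hWd
  obtain ⟨hrd, -, hShaK, q, hshaC, hval⟩ := padicValRat_shaAnOverC_of_swappedPair_anyTwin W K hGZ hGZK hmod
    hr hSel hK hodd h3 hH Dt hc0 β ι d₁ hy hdiv hndiv Wd Cd hCd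
  haveI : Finite (W.baseChange K).sha := hShaK
  obtain ⟨q', hq', hv'⟩ :=
    (missingPPartOverCAt_baseChange_iff_bsdp W 2 K Wd hGZK hmod hMilneC (by rw [hr]) h2 ⟨Cd, hCd⟩
      (by rw [hrd]; exact zero_le_one) hBd).mpr hBW
  have hqq : q' = q := Rat.cast_injective (α := ℂ) (hq'.symm.trans hshaC)
  rw [hqq, hval, X11b.Three.Koly.padicValNat_shaOrder_eq (W.baseChange K) 2] at hv'
  -- `#Ш(W_K)[2^∞] = 2^k` with `k = 2M₀ − 2 ord₂ c − 2 ord₂ C(W)`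
  obtain ⟨k, hk⟩ := X11b.SelmerCount.exists_natCard_primaryComponent_eq_pow_of_finite 2 (G := (W.baseChange K).sha)
  rw [hk, padicValNat.prime_pow] at hv'
  have hk' : (k : ℤ) = 2 * (M₀ : ℤ) - 2 * (padicValInt 2 Dt.c : ℤ) - 2 * (padicValNat 2 W.tamagawaProduct : ℤ) := by
    exact_mod_cast hv'.symm
  have hkeq : k + 2 * (padicValInt 2 Dt.c + padicValNat 2 W.tamagawaProduct) = 2 * M₀ := by omega
  rw [hk, ← pow_add, hkeq]

/-! ## §4 U₂ ⟸ WALL row 1 + Friedberg–Hoffstein + KEX′ + PRINT — no 2-converse -/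

/-- ★ **U₂ FROM THE WALL, FRIEDBERG–HOFFSTEIN AND THE 2-PRIMARY GROSS–ZAGIER INDEX RELATION — NO 2-CONVERSE, NO RESIDUAL.**  Hypotheses: the PRINT
facts (`hGZ`, `hGZK`, `hmod`, `hMilneC`, `hMP`) + Friedberg–Hoffstein `hFH` (`friedbergHoffstein_exists_heegnerField_split_twist_ne_zero`, Literature,
statement-only); `hS1` = S1′ = BSD₂ for EVERY non-CM globally minimal curve of analytic rank `0` (= WALL row 1: the four items of route
ByReductionTypeAtTwo by the reduction-type tetrachotomy at `2`, no Selmer clause); `hKEX` = KEX′ (module docstring).  CONCLUSION: `BSD₂(W)` for EVERY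
non-CM globally minimal `W` with `r_an = 1`, `#Sel₂(W) = 2` (= U₂ unfolded).  Proof: a datum (BCDT) and the parity of the functional equation give
`w(W) = −1`; FH gives an imaginary quadratic `K`, Heegner for `N_W`, `2` split, `|d_K| > 4`, with `L(W^{(d_K)},1) ≠ 0`; `2` split ⟹ `d_K ≡ 1 (8)` ⟹ `d_K`
odd; `|d_K| > 4` ⟹ `d_K ≠ −3`; a globally minimal model `Wd` of the twist (Néron, AEC VIII.8.3) is non-CM (same `j`) of analytic rank `0`, so `BSD₂(Wd)`
by S1′; a conductor-`1` datum over `K` with `P(1)` of infinite order (Gross–Zagier); KEX′; §2.  CONDITIONAL on the displayed hypotheses; proves nothing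
about BSD; closes nothing.  [cite: FriedbergHoffstein1995, main theorem] [cite: BurungaleSkinnerTianWan2024, proof of Thm. 12.3 (existence of L)]
[cite: GrossZagier1986, V.§2 (2.2)] [cite: SilvermanAEC2009, VIII.8 Cor. 8.3] [cite: BCDTJAMS2001, Thm. A] [cite: Milne1972ArithmeticAV, §1 Thm. 1] -/
theorem bsdp_of_wall_of_friedbergHoffstein_of_kex_of_facts
    (hGZ : ∀ (N : ℕ) [NeZero N] (W : WeierstrassCurve ℚ) (K : Type) [Field K] [NumberField K], gross_zagier N W K)
    (hGZK : rank_eq_analyticRank_of_analyticRank_le_one) (hmod : hasEntireLFunction_rat)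
    (hMilneC : Milne1972.bsdQuotient_baseChange_quadratic_anyModel) (hMP : nonempty_modularParametrizationData)
    (hFH : friedbergHoffstein_exists_heegnerField_split_twist_ne_zero)
    (hS1 : ∀ (W : WeierstrassCurve ℚ) [W.IsElliptic] [W.IsGloballyMinimal], ¬ W.HasCM → W.analyticRank = 0 → BSDp W 2)
    (hKEX : ∀ (W : WeierstrassCurve ℚ) [W.IsElliptic] [W.IsGloballyMinimal] [NeZero (W.conductorNorm ℤ)],
      ¬ W.HasCM → W.analyticRank = 1 → Nat.card (W.selmerGroup 2) = 2 →
      ∀ (K : Type) [Field K] [NumberField K], IsImaginaryQuadratic K →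
        Odd (NumberField.discr K) → NumberField.discr K ≠ -3 → SatisfiesHeegnerHypothesis (W.conductorNorm ℤ) K →
        ((Ideal.span {(2 : ℤ)}).primesOver (𝓞 K)).ncard = 2 →
        ∀ (Wd : WeierstrassCurve ℚ) [Wd.IsElliptic] [Wd.IsGloballyMinimal],
          (∃ C : VariableChange ℚ, C • W.quadraticTwist (NumberField.discr K : ℚ) = Wd) →
        (W.quadraticTwist (NumberField.discr K : ℚ)).entireLFunction 1 ≠ 0 →
        ∀ (Dt : ModularParametrizationData W (W.conductorNorm ℤ)) (β : ℤ) (ι : K →+* ℂ) (d₁ : KolyvaginHeegnerData Dt β ι 1),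
          ∃ M₀ : ℕ,
            (∃ Q : (W.baseChange (ringClassField K ι 1)).toAffine.Point, ((2 ^ M₀ : ℕ) : ℤ) • Q = d₁.derivedPoint) ∧
            (¬ ∃ Q : (W.baseChange (ringClassField K ι 1)).toAffine.Point, ((2 ^ (M₀ + 1) : ℕ) : ℤ) • Q = d₁.derivedPoint) ∧
            Nat.card (AddCommGroup.primaryComponent (W.baseChange K).sha 2) *
                2 ^ (2 * (padicValInt 2 Dt.c + padicValNat 2 W.tamagawaProduct)) = 2 ^ (2 * M₀)) :
    ∀ (W : WeierstrassCurve ℚ) [W.IsElliptic] [W.IsGloballyMinimal], ¬ W.HasCM → W.analyticRank = 1 →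
      Nat.card (W.selmerGroup 2) = 2 → BSDp W 2 := by
  intro W _ _ hcm hr hSel
  haveI : NeZero (W.conductorNorm ℤ) := ⟨(W.conductorNorm_pos_holds).ne'⟩
  -- the sign of the functional equation: `w(W) = −1` from `r_an(W) = 1` (parity, through a modular parametrisation datum)
  obtain ⟨Dt₀⟩ := hMP W
  have hw : W.rootNumber = -1 := by
    rcases Literature.NumberTheory.EllipticCurves.rootNumber_eq_one_or_eq_neg_one W with h1 | h1
    · exfalso
      have hev : Even W.analyticRank :=
        (Literature.Barriers.BirchSwinnertonDyer.even_analyticRank_iff_of_isNewformOf_conductorLevel Dt₀.isNewformOf).mpr h1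
      rw [hr] at hev
      exact Nat.not_even_one hev
    · exact h1
  -- Friedberg–Hoffstein: an imaginary quadratic Heegner field with `2` split, `|d_K| > 4` and `L(W^{(d_K)},1) ≠ 0`
  obtain ⟨K, _, _, hK, hB, hH, h2H, hL⟩ := hFH W hw 2 Nat.prime_two 4
  have h2 : Module.finrank ℚ K = 2 := hK.1
  have h2K : ((Ideal.span {(2 : ℤ)}).primesOver (𝓞 K)).ncard = 2 := by
    simpa using h2H 2 Nat.prime_two (dvd_refl 2)
  have hodd : Odd (NumberField.discr K) := by
    have h8 := (ncard_primesOver_two_eq_two_iff (K := K) h2).mp h2K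
    rw [Int.odd_iff]; omega
  have h3 : NumberField.discr K ≠ -3 := by
    intro h; rw [h] at hB; simp at hB
  -- a globally minimal model of the twist
  have hD0 : (NumberField.discr K : ℚ) ≠ 0 := by exact_mod_cast NumberField.discr_ne_zero K
  haveI := W.isElliptic_quadraticTwist hD0
  obtain ⟨Cd, hmin⟩ := hasGlobalMinimalModel_rat_holds (W.quadraticTwist (NumberField.discr K : ℚ))
  haveI := hmin
  -- a conductor-1 datum and its Heegner point of infinite order
  obtain ⟨Dt, β, ι, d₁, hc0⟩ := exists_kolyvaginHeegnerData_one_of_nonempty_modularParametrizationData hMP W K hK hH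
  have hy : ¬ IsOfFinAddOrder d₁.derivedPoint :=
    not_isOfFinAddOrder_derivedPoint_one_of_rankOne_of_lValue_ne_zero hmod W K (hGZ _ W K) hK hH hr hL d₁
  -- KEX′: the exact depth and the index relation
  obtain ⟨M₀, hdiv, hndiv, hsha⟩ :=
    hKEX W hcm hr hSel K hK hodd h3 hH h2K (Cd • W.quadraticTwist (NumberField.discr K : ℚ)) ⟨Cd, rfl⟩ hL Dt β ι d₁
  -- the twin is non-CM of analytic rank 0: `BSD₂(Wd)` from the wall (no Selmer clause)
  have hcmd : ¬ (Cd • W.quadraticTwist (NumberField.discr K : ℚ)).HasCM := by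
    rw [hasCM_iff_of_j_eq (((W.quadraticTwist (NumberField.discr K : ℚ)).variableChange_j Cd).trans (W.j_quadraticTwist hD0))]
    exact hcm
  have hrd : (Cd • W.quadraticTwist (NumberField.discr K : ℚ)).analyticRank = 0 := by
    rw [analyticRank_smul]
    exact ((W.quadraticTwist (NumberField.discr K : ℚ)).analyticRank_eq_zero_iff_holds (hmod _)).mpr hL
  have hBd : BSDp (Cd • W.quadraticTwist (NumberField.discr K : ℚ)) 2 := hS1 _ hcmd hrd
  -- the sign-free, budget-free, Selmer-free swapped exact descent at Ш-depth
  exact swappedPairDescentAtTwo_shaDepth_anyTwin_of_facts hGZ hGZK hmod hMilneC W hr hSel K hK hodd h3 hH Dt hc0 β ι d₁ hy M₀ hdiv hndiv hsha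
    (Cd • W.quadraticTwist (NumberField.discr K : ℚ)) ⟨Cd, rfl⟩ hBd

/-! ## §5 Losslessness: U₂ + WALL row 1 + PRINT ⟹ KEX′ -/

/-- ★ **KEX′ IS LOSSLESS: U₂ + S1′ + PRINT ⟹ KEX′** (the research hypothesis of `bsdp_of_wall_of_friedbergHoffstein_of_kex_of_facts`, text VERBATIM;
Friedberg–Hoffstein is not needed in this direction).  On every frame of KEX′ the twin `Wd` is non-CM of analytic rank `0`, so `BSD₂(Wd)` by S1′, `BSD₂(W)`
by U₂; the exact `2`-depth of the non-torsion `P(1)` exists (Mordell–Weil over `K[1]` + Krull, `KolyvaginAtTwo.exists_exactTwoDepth`), and §3 prices it.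
So modulo S1′ + PRINT the stub KEX′ is EQUIVALENT to U₂.  CONDITIONAL; proves nothing about BSD; closes nothing.
[cite: GrossZagier1986, V.§2 (2.2)] [cite: Milne1972ArithmeticAV, §1 Thm. 1] [cite: SilvermanAEC2009, Thm. VIII.6.7] -/
theorem kexAny_of_minimalTwinBSDTwo_of_wall_of_facts
    (hGZ : ∀ (N : ℕ) [NeZero N] (W : WeierstrassCurve ℚ) (K : Type) [Field K] [NumberField K], gross_zagier N W K)
    (hGZK : rank_eq_analyticRank_of_analyticRank_le_one) (hmod : hasEntireLFunction_rat)
    (hMilneC : Milne1972.bsdQuotient_baseChange_quadratic_anyModel)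
    (hS1 : ∀ (W : WeierstrassCurve ℚ) [W.IsElliptic] [W.IsGloballyMinimal], ¬ W.HasCM → W.analyticRank = 0 → BSDp W 2)
    (hTw : ∀ (W : WeierstrassCurve ℚ) [W.IsElliptic] [W.IsGloballyMinimal],
      ¬ W.HasCM → W.analyticRank = 1 → Nat.card (W.selmerGroup 2) = 2 → BSDp W 2) :
    ∀ (W : WeierstrassCurve ℚ) [W.IsElliptic] [W.IsGloballyMinimal] [NeZero (W.conductorNorm ℤ)],
      ¬ W.HasCM → W.analyticRank = 1 → Nat.card (W.selmerGroup 2) = 2 →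
      ∀ (K : Type) [Field K] [NumberField K], IsImaginaryQuadratic K →
        Odd (NumberField.discr K) → NumberField.discr K ≠ -3 → SatisfiesHeegnerHypothesis (W.conductorNorm ℤ) K →
        ((Ideal.span {(2 : ℤ)}).primesOver (𝓞 K)).ncard = 2 →
        ∀ (Wd : WeierstrassCurve ℚ) [Wd.IsElliptic] [Wd.IsGloballyMinimal],
          (∃ C : VariableChange ℚ, C • W.quadraticTwist (NumberField.discr K : ℚ) = Wd) →
        (W.quadraticTwist (NumberField.discr K : ℚ)).entireLFunction 1 ≠ 0 →
        ∀ (Dt : ModularParametrizationData W (W.conductorNorm ℤ)) (β : ℤ) (ι : K →+* ℂ) (d₁ : KolyvaginHeegnerData Dt β ι 1),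
          ∃ M₀ : ℕ,
            (∃ Q : (W.baseChange (ringClassField K ι 1)).toAffine.Point, ((2 ^ M₀ : ℕ) : ℤ) • Q = d₁.derivedPoint) ∧
            (¬ ∃ Q : (W.baseChange (ringClassField K ι 1)).toAffine.Point, ((2 ^ (M₀ + 1) : ℕ) : ℤ) • Q = d₁.derivedPoint) ∧
            Nat.card (AddCommGroup.primaryComponent (W.baseChange K).sha 2) *
                2 ^ (2 * (padicValInt 2 Dt.c + padicValNat 2 W.tamagawaProduct)) = 2 ^ (2 * M₀) := by
  intro W _ _ _ hcm hr hSel K _ _ hK hodd h3 hH _h2K Wd _ _ hWd hL Dt β ι d₁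
  obtain ⟨Cd, hCd⟩ := hWd
  have hD0 : (NumberField.discr K : ℚ) ≠ 0 := by exact_mod_cast NumberField.discr_ne_zero K
  haveI := W.isElliptic_quadraticTwist hD0
  -- the twin is non-CM of analytic rank 0: `BSD₂(Wd)` from the wall; `BSD₂(W)` from U₂
  have hcmd : ¬ Wd.HasCM := by
    rw [← hCd, hasCM_iff_of_j_eq (((W.quadraticTwist (NumberField.discr K : ℚ)).variableChange_j Cd).trans (W.j_quadraticTwist hD0))]
    exact hcm
  have hrd : Wd.analyticRank = 0 := by
    rw [← hCd, analyticRank_smul]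
    exact ((W.quadraticTwist (NumberField.discr K : ℚ)).analyticRank_eq_zero_iff_holds (hmod _)).mpr hL
  -- `P(1)` has infinite order (Gross–Zagier); its exact `2`-depth exists (Mordell–Weil over `K[1]`)
  have hy : ¬ IsOfFinAddOrder d₁.derivedPoint :=
    not_isOfFinAddOrder_derivedPoint_one_of_rankOne_of_lValue_ne_zero hmod W K (hGZ _ W K) hK hH hr hL d₁
  haveI := (finiteDimensional_and_isGalois_ringClassField hK ι one_ne_zero).1
  haveI : NumberField (ringClassField K ι 1) := NumberField.of_module_finite K _
  haveI : (W.baseChange (ringClassField K ι 1)).IsElliptic := by rw [baseChange]; infer_instance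
  haveI : Module.Finite ℤ (W.baseChange (ringClassField K ι 1)).toAffine.Point := by
    convert (W.baseChange (ringClassField K ι 1)).module_finite_point_holds
  obtain ⟨M₀, hdiv, hndiv⟩ := exists_exactTwoDepth
    (A := (W.baseChange (ringClassField K ι 1)).toAffine.Point) (y := d₁.derivedPoint) (by convert hy)
  have hc0 : Dt.c ≠ 0 := fun h ↦ Dt.cast_c_ne_zero (by rw [h, Int.cast_zero])
  exact ⟨M₀, hdiv, hndiv, natCard_sha_mul_eq_of_bsdp_anyTwin W K (hGZ _ W K) hGZK hmod hMilneC hr hSel hK hodd h3 hH Dt hc0 β ι d₁ hy hdiv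
    hndiv Wd ⟨Cd, hCd⟩ (hTw W hcm hr hSel) (hS1 Wd hcmd hrd)⟩

end Summit.BirchSwinnertonDyer.BirchSwinnertonDyer.Theorems.GenusExact.TwinSwap.AnalyticTwin

end
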